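import Literature.MathematicalPhysics.KineticTheory.HardSphereEuler
import HarnessLib

/-!
# `InfluenceLocality` (stmt-AtomisticToContinuum-13916) — bush objects (stub `stub_bushSeparation`, lead c4)

Line `ignition-cascade-refutation` (lead c4), Phase 2 (construction of `IgnitionTemplates`), architecture
"free lattice IFS top tree + bushes" (Cruxes/InfluenceLocality/Lines/ignition-cascade-refutation-c4.md §3).

A BUSH is the leaf object of the designed cascade: a binary tree of free flights embedded in `V3 = ℝ³`, in which
at every node the two children edge vectors are PERPENDICULAR, of EQUAL length, and their sum is a positive
multiple of the incoming edge vector (the 45° equal-mass hard-sphere kinematics: target along `n̂`, mover along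
`d̂ − (d̂·n̂)n̂`), with edge lengths shrinking at least geometrically with ratio `ρ ≤ 1/4` from one generation to the
next. Words `w : List Bool` address the nodes (`[]` = root = the bush's entry node, `b :: w` = child `b` of `w`, so
the HEAD of a word is the LAST move); `pos w` is the node position and the edge of `b :: w` is the closed segment
from `pos w` to `pos (b :: w)`.

This file introduces only the OBJECTS of the registered stub `stub_bushSeparation` of the skeleton
(Cruxes/InfluenceLocality/Lines/ignition_cascade_refutation.lean, rev 5), verbatim: the predicate `IsBush`, the
element sets `bushEdge` / `bushElem` (nodes `(w, none)` and closed edges `(w, some b)`), the admissibility predicate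
`bushIdx` at depth `K`, the depth `bushDepth` and the incidence relation `bushIncident`. The separation theorem
`stub_bushSeparation` (ball nesting) is Negative/BushSeparation.lean. Design-independent; asserts no Theses decl.
-/

namespace Summit.AtomisticToContinuum.HydrodynamicLimit.Theorems.InfluenceLocality.Negative

open scoped InnerProductSpace
open Literature.MathematicalPhysics.KineticTheory

noncomputable section

/-- A bush: node positions indexed by binary words (head = last move), with the 45°-kinematics constraints and
geometric decay of the edge lengths. `μ k` is the common edge length of generation `k` (edges into nodes of depth `k`). -/
structure IsBush (pos : List Bool → V3) (μ : ℕ → ℝ) (ρ : ℝ) (K : ℕ) : Prop where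
  /-- edge lengths: the edge into a node of depth `k+1 ≤ K` has length `μ (k+1)` -/
  norm_edge : ∀ (w : List Bool) (b : Bool), w.length < K → ‖pos (b :: w) - pos w‖ = μ (w.length + 1)
  /-- the two children edges are perpendicular -/
  perp : ∀ (w : List Bool), w.length < K → ⟪pos (true :: w) - pos w, pos (false :: w) - pos w⟫_ℝ = 0
  /-- forward: the sum of the two children edges is a positive multiple of the incoming edge (root excluded) -/
  forward : ∀ (w : List Bool) (b₀ : Bool) (w₀ : List Bool), w = b₀ :: w₀ → w.length < K →
    ∃ c : ℝ, 0 < c ∧ (pos (true :: w) - pos w) + (pos (false :: w) - pos w) = c • (pos w - pos w₀)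
  /-- lengths are positive and decay with ratio at most `ρ` -/
  μ_pos : ∀ k, 0 < μ k
  μ_decay : ∀ k, μ (k + 1) ≤ ρ * μ k
  ρ_le : ρ ≤ 1 / 4
  ρ_nonneg : 0 ≤ ρ

/-- The closed edge into the node `b :: w`, as a set. -/
def bushEdge (pos : List Bool → V3) (b : Bool) (w : List Bool) : Set V3 :=
  segment ℝ (pos w) (pos (b :: w))

/-- Elements of a bush of depth `K`: nodes `(w, none)` with `w.length ≤ K` and edges `(w, some b)` (the edge into
`b :: w`) with `w.length < K`. -/
def bushElem (pos : List Bool → V3) : List Bool × Option Bool → Set V3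
  | (w, none) => {pos w}
  | (w, some b) => bushEdge pos b w

/-- Admissible element indices at depth `K`. -/
def bushIdx (K : ℕ) (e : List Bool × Option Bool) : Prop :=
  match e with
  | (w, none) => w.length ≤ K
  | (w, some _) => w.length < K

/-- Depth of an element (a node's depth; an edge's deeper endpoint's depth). -/
def bushDepth (e : List Bool × Option Bool) : ℕ :=
  match e with
  | (w, none) => w.length
  | (w, some _) => w.length + 1

/-- Incidence: equal elements; a node and an edge having it as an endpoint; two edges sharing an endpoint. -/
def bushIncident (e f : List Bool × Option Bool) : Prop :=
  e = f ∨
  (match e, f with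
   | (w, none), (w', some b') => w = w' ∨ w = b' :: w'
   | (w, some b), (w', none) => w' = w ∨ w' = b :: w
   | (w, some b), (w', some b') => w = w' ∨ w = b' :: w' ∨ w' = b :: w
   | (_, none), (_, none) => False)

end

end Summit.AtomisticToContinuum.HydrodynamicLimit.Theorems.InfluenceLocality.Negative
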